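import Summits.QuantumFields.BalabanUV.Beta.D1BFx.PackedSlotMultilinear
import Summits.QuantumFields.BalabanUV.Beta.FP.SecondVarPolarisation

/-!
# `BalabanUV.Beta.FP.SecondVarKernelLaw` — road «FP» for binder row D1, ROUTE T, junction (J-b) «FUNCTIONAL → KERNEL» (memo `N2B-DESIGN.md` §28,
# `TID-LETTER-SPEC.md` § F.6): **A (STEP)-DOOR-SHAPED LAW `secondVar N = secondVar F + secondVar G` HOLDING ALONG EVERY PACKED DIRECTION IS AN
# IDENTITY OF TWO-POINT KERNELS** — polarisation done at the kernel level, once, for all three systems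

WHAT.  The road's (STEP) door (`NestedStepLawOneShotJetsGraded` p323821 and its torus calls #12 ∕ #19) is an identity of the ONE-direction functional
`secondVar A₀ A₁ A₂ = tr(A₀⁻¹A₂) − tr(A₀⁻¹A₁A₀⁻¹A₁)` along a source `h`; the END's socket (`StepDefectInherit.stepDefect_inherit`, `hfin`) and an4's
`HessianTelescopingKKT.StepRecursion` are identities of TWO-POINT KERNELS `(a, b) ↦ 𝒯 a b`.  Once the rows are discharged for EVERY direction, the door's
jets are PACKED over the finite bond set `σ` of the torus: first jets `Σ_k r k • X₁ k`, second jets `Σ_{k,l} (r k·r l) • X₂ k l` (the periodised tables are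
delivered per bond: `…RowsGradedLevelZero`'s `hH₁ : H₁ = (−2c) • Σ_b h b • H₁^{b}`, leaf-02's `hQ₁₁`, …).  This file is the [folklore] algebra that turns
«the door for every weight `r : σ → ℝ`» into «the door for every bond pair `(a, b)`», with the two-point kernel of a system
`K_X a b := mixedVar X₀ (X₁ a) (X₁ b) (X₂ a b)` (`SecondVarPolarisation.mixedVar`, p303861):
* §1 `mixedVar_packed ∕ secondVar_packed` — the functionals at packed jets are the `Σ_{k,l} r k·r′ l`-superpositions of the kernel (road BF-x's
  `PackedSlotMultilinear.hessT_packed` ∕ `MixedVarPackedHess.mixedVar_eq_two_mul_hessT` BY NAME — d1-p2 g17, not restated);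
* §2 `add_swap_eq_zero_of_forall_quadForm ∕ symm_kernel_law_of_forall_quadForm ∕ kernel_law_of_forall_quadForm_of_symm` (+ `quadForm_indicator₂`) — a real quadratic form that
  vanishes for every weight has vanishing SYMMETRISED kernel (weights `δ_a`, `δ_b`, `δ_a + δ_b`); three-kernel form; symmetric kernels are determined;
* §3 **`mixedVar_symm_kernel_law_of_secondVar_law`** ∕ **`mixedVar_kernel_law_of_secondVar_law`** — THE KERNEL DOOR: if
  `secondVar N₀ (Σ r•N₁) (ΣΣ rr•N₂) = secondVar F₀ (Σ r•F₁) (ΣΣ rr•F₂) + secondVar G₀ (Σ r•G₁) (ΣΣ rr•G₂)` for every `r`, then the symmetrised kernels add, and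
  under symmetric second-order families (`X₂ k l = X₂ l k`, mixed partials) `K_N a b = K_F a b + K_G a b` for every bond pair;
* §4 `sum_smul_signTwist_zeroSlice ∕ sum_smul_kkt_zeroSlice ∕ sum_sum_smul_kkt_zeroSlice` — the GRADED ((−)-placed, R-FP-54′) and plain zero-slice bordered
  jets are linear in their (form, averaging) tables, so bordered jets with packed TABLES are packed JETS (the shape §3 consumes);
  `sum_sum_smul_symmetrise` — the symmetry hypothesis of §3 ∕ §5 costs nothing (a packed second jet only sees the symmetrisation of its family, so
  order-2 REPRESENTATIVES of the dictionary are admissible);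
* §5 **`mixedVar_kernel_law_of_secondVar_law_graded`** — §3 for three GRADED bordered systems with the packings INSIDE the blocks (the literal shape of the
  torus calls' conclusions once every row holds for every direction).
No estimate; no `def`, no `def … : Prop`, nothing cited, 0 sorry.  NEXT BRICKS (not here): the kernel of a graded bordered system in LEG currency (the graded
twin of BF-x's TA4 `mixedVar_kkt_fromRows_zero`), then (B2) the three naming identities with the dictionary (an2 (J-a), leaf-05 `RelInvPeriodised*`) and the
de-periodisation `M′ → ∞` (`DeperiodisationVanishing.eq_of_tendsto_periodisation` ∕ `GAN24.DirichletExhaustionDeperiodise.eq_of_tsum_translate_eq`).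

HONEST DEPENDENCY (page 1, mandatory): continuum YM on T⁴ ⇐ BetaPertH ∧ nine spine estimates (0/9 proved); BetaPertH ⇐ (D1) ∧ (D4) ∧ CAP+tail;
G-an2-4 gates asym, D1 and NE2/3/4.  HONEST FRAMING (cell contract, verbatim): «discharging `BetaPertH` makes Bałaban's UV stability UNCONDITIONAL —
a real constructive-QFT result; it is NOT the continuum limit and NOT the Clay problem.»  ABSOLUTE RULE (cell charter, verbatim): «No internally-minted
statement may enter as a cited fact. Every hypothesis is either kernel-proved in this package or a verbatim quotation of a PUBLISHED theorem with page
reference. The manuscript(s) under audit are NOT citable for their own disputed steps — they are the thing under adjudication; programme-internal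
(2001/route/tribunal) claims are never citable.»  [folklore] finite (bi)linear algebra; nothing of Bałaban's asserted; 0 estimates; 0∕4 row-D1 binders;
NOT (T-ID), NOT SDF, NOT D1, NOT BetaPertH, NOT continuum, NOT Clay.  Road «FP» OWNER, b2b-balaban-beta-d1-p3 gen 21, 2026-08-22.  No existing file touched.
-/

noncomputable section

open scoped BigOperators Matrix

namespace Summit.QuantumFields.BalabanUV.Beta.FP.SecondVarKernelLaw

open Matrix
open Literature.MathematicalPhysics.QuantumFieldTheory.Balaban1983to89.Beta.Composition (kkt)
open Summit.QuantumFields.BalabanUV.Beta.D1BFx.LogDetSecondVariation (secondVar)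
open Summit.QuantumFields.BalabanUV.Beta.FP.SecondVarPolarisation (mixedVar mixedVar_self mixedVar_symm)
open Summit.QuantumFields.BalabanUV.Beta.D1BFx.MixedVarPackedHess (hessT mixedVar_eq_two_mul_hessT)
open Summit.QuantumFields.BalabanUV.Beta.D1BFx.PackedSlotMultilinear (hessT_packed)

/-! ## §1 The one-loop functionals at packed jets are superpositions of the two-point kernel -/

section Packed

variable {ι σ : Type*} [Fintype ι] [DecidableEq ι] [Fintype σ]

/-- [folklore] **`mixedVar` AT PACKED JETS**: for first jets `Σ_k r k • V k`, `Σ_l r′ l • V′ l` and the packed mixed second jet `Σ_{k,l} (r k·r′ l) • W k l`,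
`mixedVar A₀ (Σ r•V) (Σ r′•V′) (Σ rr′•W) = Σ_{k,l} (r k·r′ l) · mixedVar A₀ (V k) (V′ l) (W k l)` — road BF-x's `hessT_packed` read through
`mixedVar = 2·hessT A₀⁻¹`. -/
theorem mixedVar_packed (A₀ : Matrix ι ι ℝ) (r r' : σ → ℝ) (V V' : σ → Matrix ι ι ℝ) (W : σ → σ → Matrix ι ι ℝ) :
    mixedVar A₀ (∑ k, r k • V k) (∑ l, r' l • V' l) (∑ k, ∑ l, (r k * r' l) • W k l)
      = ∑ k, ∑ l, (r k * r' l) * mixedVar A₀ (V k) (V' l) (W k l) := by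
  -- the road's `SecondVarPolarisation.mixedVar` and road BF-x's `SliceTransferJetsMixed.mixedVar` are the same expression (defeq)
  have e : ∀ B B' D : Matrix ι ι ℝ, mixedVar A₀ B B' D = 2 * hessT A₀⁻¹ B B' D := fun B B' D => mixedVar_eq_two_mul_hessT A₀ B B' D
  rw [e, hessT_packed, Finset.mul_sum]
  refine Finset.sum_congr rfl fun k _ => ?_
  rw [Finset.mul_sum]
  refine Finset.sum_congr rfl fun l _ => ?_
  rw [e]
  ring

/-- [folklore] **`secondVar` AT A PACKED 2-JET** (the ONE-direction functional of the (STEP) door): with first jet `Σ_k r k • V k` and second jet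
`Σ_{k,l} (r k·r l) • W k l`, `secondVar A₀ (Σ r•V) (Σ rr•W) = Σ_{k,l} (r k·r l) · mixedVar A₀ (V k) (V l) (W k l)` — a real quadratic form in the weight `r`
whose kernel is the two-point functional of the per-bond jets. -/
theorem secondVar_packed (A₀ : Matrix ι ι ℝ) (r : σ → ℝ) (V : σ → Matrix ι ι ℝ) (W : σ → σ → Matrix ι ι ℝ) :
    secondVar A₀ (∑ k, r k • V k) (∑ k, ∑ l, (r k * r l) • W k l) = ∑ k, ∑ l, (r k * r l) * mixedVar A₀ (V k) (V l) (W k l) := by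
  rw [← mixedVar_self]
  exact mixedVar_packed A₀ r r V V W

omit [Fintype σ] in
/-- [folklore] THE TWO-POINT KERNEL OF A SYSTEM WITH SYMMETRIC SECOND-ORDER FAMILY IS SYMMETRIC: `mixedVar A₀ (V a) (V b) (W a b) = mixedVar A₀ (V b) (V a) (W b a)`
when `W a b = W b a` (the bubble is symmetric by trace cyclicity — `mixedVar_symm` —, the tadpole by hypothesis). -/
theorem mixedVar_kernel_symm (A₀ : Matrix ι ι ℝ) (V : σ → Matrix ι ι ℝ) (W : σ → σ → Matrix ι ι ℝ) (hW : ∀ k l, W k l = W l k) (a b : σ) :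
    mixedVar A₀ (V a) (V b) (W a b) = mixedVar A₀ (V b) (V a) (W b a) := by
  rw [mixedVar_symm, hW a b]

end Packed

/-! ## §2 A quadratic form that vanishes for every weight has vanishing symmetrised kernel -/

section QuadForm

variable {σ : Type*} [Fintype σ] [DecidableEq σ]

/-- [folklore] The quadratic form of a kernel at a pair of indicator weights: `Σ_{k,l} δ_x k·δ_y l·K k l = K x y`. -/
theorem quadForm_indicator₂ (K : σ → σ → ℝ) (x y : σ) :
    ∑ k, ∑ l, (if k = x then (1 : ℝ) else 0) * (if l = y then (1 : ℝ) else 0) * K k l = K x y := by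
  rw [Finset.sum_eq_single_of_mem x (Finset.mem_univ x) (fun k _ hk => by simp [hk]),
    Finset.sum_eq_single_of_mem y (Finset.mem_univ y) (fun l _ hl => by simp [hl])]
  simp

/-- [folklore] **A REAL QUADRATIC FORM VANISHING FOR EVERY WEIGHT HAS VANISHING SYMMETRISED KERNEL**: if `Σ_{k,l} r k·r l·K k l = 0` for every
`r : σ → ℝ` then `K a b + K b a = 0` for every pair (weights `δ_a`, `δ_b`, `δ_a + δ_b`).  The antisymmetric part of `K` is of course not seen. -/
theorem add_swap_eq_zero_of_forall_quadForm (K : σ → σ → ℝ) (h : ∀ r : σ → ℝ, ∑ k, ∑ l, r k * r l * K k l = 0) (a b : σ) :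
    K a b + K b a = 0 := by
  have ha := h (fun k => if k = a then 1 else 0)
  have hb := h (fun k => if k = b then 1 else 0)
  have hs := h (fun k => (if k = a then 1 else 0) + (if k = b then 1 else 0))
  simp only [add_mul, mul_add, Finset.sum_add_distrib] at hs
  rw [quadForm_indicator₂, quadForm_indicator₂, quadForm_indicator₂, quadForm_indicator₂] at hs
  rw [quadForm_indicator₂] at ha hb
  linarith

/-- [folklore] **THREE-KERNEL FORM**: if `Σ rr·K_N = Σ rr·K_F + Σ rr·K_G` for every weight then the SYMMETRISED kernels add:
`K_N a b + K_N b a = (K_F a b + K_F b a) + (K_G a b + K_G b a)`. -/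
theorem symm_kernel_law_of_forall_quadForm (KN KF KG : σ → σ → ℝ)
    (h : ∀ r : σ → ℝ, ∑ k, ∑ l, r k * r l * KN k l = (∑ k, ∑ l, r k * r l * KF k l) + ∑ k, ∑ l, r k * r l * KG k l) (a b : σ) :
    KN a b + KN b a = (KF a b + KF b a) + (KG a b + KG b a) := by
  have h0 : ∀ r : σ → ℝ, ∑ k, ∑ l, r k * r l * (KN k l - KF k l - KG k l) = 0 := fun r => by
    simp only [mul_sub, Finset.sum_sub_distrib]
    rw [h r]
    ring
  have := add_swap_eq_zero_of_forall_quadForm (fun k l => KN k l - KF k l - KG k l) h0 a b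
  linarith

/-- [folklore] **SYMMETRIC KERNELS ARE DETERMINED BY THEIR QUADRATIC FORMS**: under `K_X a b = K_X b a` (`X = N, F, G`) the law for every weight gives
`K_N a b = K_F a b + K_G a b` for every pair. -/
theorem kernel_law_of_forall_quadForm_of_symm (KN KF KG : σ → σ → ℝ)
    (hN : ∀ a b, KN a b = KN b a) (hF : ∀ a b, KF a b = KF b a) (hG : ∀ a b, KG a b = KG b a)
    (h : ∀ r : σ → ℝ, ∑ k, ∑ l, r k * r l * KN k l = (∑ k, ∑ l, r k * r l * KF k l) + ∑ k, ∑ l, r k * r l * KG k l) (a b : σ) :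
    KN a b = KF a b + KG a b := by
  have := symm_kernel_law_of_forall_quadForm KN KF KG h a b
  rw [← hN a b, ← hF a b, ← hG a b] at this
  linarith

end QuadForm

/-! ## §3 The kernel door -/

section KernelDoor

variable {ι₁ ι₂ ι₃ σ : Type*} [Fintype ι₁] [DecidableEq ι₁] [Fintype ι₂] [DecidableEq ι₂] [Fintype ι₃] [DecidableEq ι₃]
  [Fintype σ] [DecidableEq σ]

/-- [folklore] **THE KERNEL DOOR, SYMMETRISED FORM (no hypothesis on the second-order families)**: if the (STEP)-door-shaped law
`secondVar N₀ (Σ_k r k • N₁ k) (Σ_{k,l} r k·r l • N₂ k l) = secondVar F₀ (Σ r•F₁) (ΣΣ rr•F₂) + secondVar G₀ (Σ r•G₁) (ΣΣ rr•G₂)` holds for EVERY weight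
`r : σ → ℝ`, then for every bond pair `(a, b)` the symmetrised two-point kernels add:
`K_N a b + K_N b a = (K_F a b + K_F b a) + (K_G a b + K_G b a)`, `K_X a b := mixedVar X₀ (X₁ a) (X₁ b) (X₂ a b)`. -/
theorem mixedVar_symm_kernel_law_of_secondVar_law
    (N₀ : Matrix ι₁ ι₁ ℝ) (N₁ : σ → Matrix ι₁ ι₁ ℝ) (N₂ : σ → σ → Matrix ι₁ ι₁ ℝ)
    (F₀ : Matrix ι₂ ι₂ ℝ) (F₁ : σ → Matrix ι₂ ι₂ ℝ) (F₂ : σ → σ → Matrix ι₂ ι₂ ℝ)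
    (G₀ : Matrix ι₃ ι₃ ℝ) (G₁ : σ → Matrix ι₃ ι₃ ℝ) (G₂ : σ → σ → Matrix ι₃ ι₃ ℝ)
    (hlaw : ∀ r : σ → ℝ,
      secondVar N₀ (∑ k, r k • N₁ k) (∑ k, ∑ l, (r k * r l) • N₂ k l)
        = secondVar F₀ (∑ k, r k • F₁ k) (∑ k, ∑ l, (r k * r l) • F₂ k l) + secondVar G₀ (∑ k, r k • G₁ k) (∑ k, ∑ l, (r k * r l) • G₂ k l))
    (a b : σ) :
    mixedVar N₀ (N₁ a) (N₁ b) (N₂ a b) + mixedVar N₀ (N₁ b) (N₁ a) (N₂ b a)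
      = (mixedVar F₀ (F₁ a) (F₁ b) (F₂ a b) + mixedVar F₀ (F₁ b) (F₁ a) (F₂ b a))
        + (mixedVar G₀ (G₁ a) (G₁ b) (G₂ a b) + mixedVar G₀ (G₁ b) (G₁ a) (G₂ b a)) := by
  refine symm_kernel_law_of_forall_quadForm (fun k l => mixedVar N₀ (N₁ k) (N₁ l) (N₂ k l))
    (fun k l => mixedVar F₀ (F₁ k) (F₁ l) (F₂ k l)) (fun k l => mixedVar G₀ (G₁ k) (G₁ l) (G₂ k l)) (fun r => ?_) a b
  rw [← secondVar_packed, ← secondVar_packed, ← secondVar_packed]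
  exact hlaw r

/-- [folklore] **THE KERNEL DOOR**: under SYMMETRIC second-order families (`X₂ k l = X₂ l k`, `X = N, F, G` — mixed second partials of the tables), the
(STEP)-door-shaped law for every weight `r : σ → ℝ` IS the identity of two-point kernels
`mixedVar N₀ (N₁ a) (N₁ b) (N₂ a b) = mixedVar F₀ (F₁ a) (F₁ b) (F₂ a b) + mixedVar G₀ (G₁ a) (G₁ b) (G₂ a b)` for every bond pair `(a, b)` — the shape of
the END's `hfin` ∕ an4's `StepRecursion` before de-periodisation.  Conversely the kernel identity gives back the law for every `r` by `secondVar_packed`. -/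
theorem mixedVar_kernel_law_of_secondVar_law
    (N₀ : Matrix ι₁ ι₁ ℝ) (N₁ : σ → Matrix ι₁ ι₁ ℝ) (N₂ : σ → σ → Matrix ι₁ ι₁ ℝ)
    (F₀ : Matrix ι₂ ι₂ ℝ) (F₁ : σ → Matrix ι₂ ι₂ ℝ) (F₂ : σ → σ → Matrix ι₂ ι₂ ℝ)
    (G₀ : Matrix ι₃ ι₃ ℝ) (G₁ : σ → Matrix ι₃ ι₃ ℝ) (G₂ : σ → σ → Matrix ι₃ ι₃ ℝ)
    (hN₂ : ∀ k l, N₂ k l = N₂ l k) (hF₂ : ∀ k l, F₂ k l = F₂ l k) (hG₂ : ∀ k l, G₂ k l = G₂ l k)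
    (hlaw : ∀ r : σ → ℝ,
      secondVar N₀ (∑ k, r k • N₁ k) (∑ k, ∑ l, (r k * r l) • N₂ k l)
        = secondVar F₀ (∑ k, r k • F₁ k) (∑ k, ∑ l, (r k * r l) • F₂ k l) + secondVar G₀ (∑ k, r k • G₁ k) (∑ k, ∑ l, (r k * r l) • G₂ k l))
    (a b : σ) :
    mixedVar N₀ (N₁ a) (N₁ b) (N₂ a b) = mixedVar F₀ (F₁ a) (F₁ b) (F₂ a b) + mixedVar G₀ (G₁ a) (G₁ b) (G₂ a b) := by
  refine kernel_law_of_forall_quadForm_of_symm (fun k l => mixedVar N₀ (N₁ k) (N₁ l) (N₂ k l))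
    (fun k l => mixedVar F₀ (F₁ k) (F₁ l) (F₂ k l)) (fun k l => mixedVar G₀ (G₁ k) (G₁ l) (G₂ k l))
    (mixedVar_kernel_symm N₀ N₁ N₂ hN₂) (mixedVar_kernel_symm F₀ F₁ F₂ hF₂) (mixedVar_kernel_symm G₀ G₁ G₂ hG₂) (fun r => ?_) a b
  rw [← secondVar_packed, ← secondVar_packed, ← secondVar_packed]
  exact hlaw r

omit [DecidableEq σ] in
/-- [folklore] CONVERSE (bookkeeping): the kernel identity for every pair gives the law for every weight. -/
theorem secondVar_law_of_mixedVar_kernel_law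
    (N₀ : Matrix ι₁ ι₁ ℝ) (N₁ : σ → Matrix ι₁ ι₁ ℝ) (N₂ : σ → σ → Matrix ι₁ ι₁ ℝ)
    (F₀ : Matrix ι₂ ι₂ ℝ) (F₁ : σ → Matrix ι₂ ι₂ ℝ) (F₂ : σ → σ → Matrix ι₂ ι₂ ℝ)
    (G₀ : Matrix ι₃ ι₃ ℝ) (G₁ : σ → Matrix ι₃ ι₃ ℝ) (G₂ : σ → σ → Matrix ι₃ ι₃ ℝ)
    (hker : ∀ a b : σ, mixedVar N₀ (N₁ a) (N₁ b) (N₂ a b) = mixedVar F₀ (F₁ a) (F₁ b) (F₂ a b) + mixedVar G₀ (G₁ a) (G₁ b) (G₂ a b))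
    (r : σ → ℝ) :
    secondVar N₀ (∑ k, r k • N₁ k) (∑ k, ∑ l, (r k * r l) • N₂ k l)
      = secondVar F₀ (∑ k, r k • F₁ k) (∑ k, ∑ l, (r k * r l) • F₂ k l) + secondVar G₀ (∑ k, r k • G₁ k) (∑ k, ∑ l, (r k * r l) • G₂ k l) := by
  rw [secondVar_packed, secondVar_packed, secondVar_packed, ← Finset.sum_add_distrib]
  refine Finset.sum_congr rfl fun k _ => ?_
  rw [← Finset.sum_add_distrib]
  refine Finset.sum_congr rfl fun l _ => ?_
  rw [hker k l, mul_add]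

end KernelDoor

/-! ## §4 Bordered jets with packed tables are packed jets -/

section Bordered

variable {ν κ ρ σ : Type*} [Fintype σ]

/-- [folklore] **THE GRADED ZERO-SLICE BORDERED JET IS LINEAR IN ITS TABLES**: `Σ_k r k • [[K k, −[Q k;0]ᵀ],[[Q k;0], 0]] = [[Σ r•K, −[Σ r•Q;0]ᵀ],[[Σ r•Q;0], 0]]`
(R-FP-54′'s (−)-placed first jets). -/
theorem sum_smul_signTwist_zeroSlice (r : σ → ℝ) (K : σ → Matrix ν ν ℝ) (Q : σ → Matrix κ ν ℝ) :
    ∑ k, r k • fromBlocks (K k) (-(fromRows (Q k) (0 : Matrix ρ ν ℝ))ᵀ) (fromRows (Q k) (0 : Matrix ρ ν ℝ)) 0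
      = fromBlocks (∑ k, r k • K k) (-(fromRows (∑ k, r k • Q k) (0 : Matrix ρ ν ℝ))ᵀ) (fromRows (∑ k, r k • Q k) (0 : Matrix ρ ν ℝ)) 0 := by
  ext i j
  rcases i with i | i | i <;> rcases j with j | j | j <;>
    simp [Matrix.sum_apply, Matrix.fromBlocks, Matrix.fromRows, Finset.sum_neg_distrib]

/-- [folklore] **THE ZERO-SLICE BORDERED JET IS LINEAR IN ITS TABLES** (one weight): `Σ_k r k • kkt (K k) [Q k;0] = kkt (Σ r•K) [Σ r•Q; 0]`. -/
theorem sum_smul_kkt_zeroSlice (r : σ → ℝ) (K : σ → Matrix ν ν ℝ) (Q : σ → Matrix κ ν ℝ) :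
    ∑ k, r k • kkt (K k) (fromRows (Q k) (0 : Matrix ρ ν ℝ)) = kkt (∑ k, r k • K k) (fromRows (∑ k, r k • Q k) (0 : Matrix ρ ν ℝ)) := by
  ext i j
  rcases i with i | i | i <;> rcases j with j | j | j <;>
    simp [kkt, Matrix.sum_apply, Matrix.fromBlocks, Matrix.fromRows]

/-- [folklore] **THE ZERO-SLICE BORDERED SECOND JET WITH PACKED TABLES IS A PACKED JET**:
`Σ_{k,l} (r k·r′ l) • kkt (K k l) [Q k l;0] = kkt (ΣΣ rr′•K) [ΣΣ rr′•Q; 0]`. -/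
theorem sum_sum_smul_kkt_zeroSlice (r r' : σ → ℝ) (K : σ → σ → Matrix ν ν ℝ) (Q : σ → σ → Matrix κ ν ℝ) :
    ∑ k, ∑ l, (r k * r' l) • kkt (K k l) (fromRows (Q k l) (0 : Matrix ρ ν ℝ))
      = kkt (∑ k, ∑ l, (r k * r' l) • K k l) (fromRows (∑ k, ∑ l, (r k * r' l) • Q k l) (0 : Matrix ρ ν ℝ)) := by
  ext i j
  rcases i with i | i | i <;> rcases j with j | j | j <;>
    simp [kkt, Matrix.sum_apply, Matrix.fromBlocks, Matrix.fromRows]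

end Bordered

section Symmetrise

variable {σ M : Type*} [Fintype σ] [AddCommGroup M] [Module ℝ M]

/-- [folklore] Re-indexing a packed second jet: `Σ_{k,l} (r k·r l) • X l k = Σ_{k,l} (r k·r l) • X k l`. -/
theorem sum_sum_smul_swap (r : σ → ℝ) (X : σ → σ → M) :
    ∑ k, ∑ l, (r k * r l) • X l k = ∑ k, ∑ l, (r k * r l) • X k l := by
  rw [Finset.sum_comm]
  exact Finset.sum_congr rfl fun k _ => Finset.sum_congr rfl fun l _ => by rw [mul_comm]

/-- [folklore] **THE SYMMETRY HYPOTHESIS OF §3 ∕ §5 COSTS NOTHING**: a packed second jet only sees the SYMMETRISATION of its table family —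
`Σ_{k,l} (r k·r l) • ½•(X k l + X l k) = Σ_{k,l} (r k·r l) • X k l` — so any per-pair family (e.g. an order-2 REPRESENTATIVE of the dictionary, W-FP-19-18)
may be replaced by its symmetrisation before the kernel door is read. -/
theorem sum_sum_smul_symmetrise (r : σ → ℝ) (X : σ → σ → M) :
    ∑ k, ∑ l, (r k * r l) • ((1 / 2 : ℝ) • (X k l + X l k)) = ∑ k, ∑ l, (r k * r l) • X k l := by
  simp only [smul_add, Finset.sum_add_distrib, smul_comm (_ * _ : ℝ) (1 / 2 : ℝ), ← Finset.smul_sum]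
  rw [sum_sum_smul_swap, ← add_smul]
  norm_num

end Symmetrise


/-! ## §5 The kernel door for three graded bordered systems (the torus calls' literal shape) -/

section GradedDoor

variable {ν₁ κ₁ ρ₁ ν₂ κ₂ ρ₂ ν₃ κ₃ ρ₃ σ : Type*}
  [Fintype ν₁] [Fintype κ₁] [Fintype ρ₁] [DecidableEq ν₁] [DecidableEq κ₁] [DecidableEq ρ₁]
  [Fintype ν₂] [Fintype κ₂] [Fintype ρ₂] [DecidableEq ν₂] [DecidableEq κ₂] [DecidableEq ρ₂]
  [Fintype ν₃] [Fintype κ₃] [Fintype ρ₃] [DecidableEq ν₃] [DecidableEq κ₃] [DecidableEq ρ₃]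
  [Fintype σ] [DecidableEq σ]

/-- [folklore] **THE KERNEL DOOR FOR GRADED ZERO-SLICE BORDERED SYSTEMS.**  Three systems `N` (base `N₀`, e.g. the one-shot literal `kkt H₀ [𝔔₀; P]`),
`F` (base `F₀`, the fine sliced system `kkt H₀ [Q₁₀; τ₁]`), `G` (base `G₀`, the coarse ∕ level-`(j+1)` sliced system), each with PER-BOND form tables
`X₁ k` ∕ `X₂ k l` and averaging tables `Y₁ k` ∕ `Y₂ k l` (`X₂`, `Y₂` symmetric in the bond pair), graded first jets `[[X₁, −[Y₁;0]ᵀ],[[Y₁;0],0]]` and second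
jets `kkt X₂ [Y₂;0]`.  If the (STEP) door holds along EVERY weight `r : σ → ℝ` with the tables packed INSIDE the blocks — the literal shape of the torus
calls #12 ∕ #19 once their rows hold for every direction — then for every bond pair `(a, b)`:
`mixedVar N₀ J_N(a) J_N(b) J_N(a,b) = mixedVar F₀ J_F(a) J_F(b) J_F(a,b) + mixedVar G₀ J_G(a) J_G(b) J_G(a,b)` — three TORUS KERNELS. -/
theorem mixedVar_kernel_law_of_secondVar_law_graded
    (N₀ : Matrix (ν₁ ⊕ (κ₁ ⊕ ρ₁)) (ν₁ ⊕ (κ₁ ⊕ ρ₁)) ℝ) (N₁ : σ → Matrix ν₁ ν₁ ℝ) (N₂ : σ → σ → Matrix ν₁ ν₁ ℝ)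
    (M₁ : σ → Matrix κ₁ ν₁ ℝ) (M₂ : σ → σ → Matrix κ₁ ν₁ ℝ)
    (F₀ : Matrix (ν₂ ⊕ (κ₂ ⊕ ρ₂)) (ν₂ ⊕ (κ₂ ⊕ ρ₂)) ℝ) (F₁ : σ → Matrix ν₂ ν₂ ℝ) (F₂ : σ → σ → Matrix ν₂ ν₂ ℝ)
    (E₁ : σ → Matrix κ₂ ν₂ ℝ) (E₂ : σ → σ → Matrix κ₂ ν₂ ℝ)
    (G₀ : Matrix (ν₃ ⊕ (κ₃ ⊕ ρ₃)) (ν₃ ⊕ (κ₃ ⊕ ρ₃)) ℝ) (G₁ : σ → Matrix ν₃ ν₃ ℝ) (G₂ : σ → σ → Matrix ν₃ ν₃ ℝ)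
    (R₁ : σ → Matrix κ₃ ν₃ ℝ) (R₂ : σ → σ → Matrix κ₃ ν₃ ℝ)
    (hN₂ : ∀ k l, N₂ k l = N₂ l k) (hM₂ : ∀ k l, M₂ k l = M₂ l k) (hF₂ : ∀ k l, F₂ k l = F₂ l k) (hE₂ : ∀ k l, E₂ k l = E₂ l k)
    (hG₂ : ∀ k l, G₂ k l = G₂ l k) (hR₂ : ∀ k l, R₂ k l = R₂ l k)
    (hlaw : ∀ r : σ → ℝ,
      secondVar N₀
          (fromBlocks (∑ k, r k • N₁ k) (-(fromRows (∑ k, r k • M₁ k) (0 : Matrix ρ₁ ν₁ ℝ))ᵀ) (fromRows (∑ k, r k • M₁ k) (0 : Matrix ρ₁ ν₁ ℝ)) 0)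
          (kkt (∑ k, ∑ l, (r k * r l) • N₂ k l) (fromRows (∑ k, ∑ l, (r k * r l) • M₂ k l) (0 : Matrix ρ₁ ν₁ ℝ)))
        = secondVar F₀
            (fromBlocks (∑ k, r k • F₁ k) (-(fromRows (∑ k, r k • E₁ k) (0 : Matrix ρ₂ ν₂ ℝ))ᵀ) (fromRows (∑ k, r k • E₁ k) (0 : Matrix ρ₂ ν₂ ℝ)) 0)
            (kkt (∑ k, ∑ l, (r k * r l) • F₂ k l) (fromRows (∑ k, ∑ l, (r k * r l) • E₂ k l) (0 : Matrix ρ₂ ν₂ ℝ)))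
          + secondVar G₀
            (fromBlocks (∑ k, r k • G₁ k) (-(fromRows (∑ k, r k • R₁ k) (0 : Matrix ρ₃ ν₃ ℝ))ᵀ) (fromRows (∑ k, r k • R₁ k) (0 : Matrix ρ₃ ν₃ ℝ)) 0)
            (kkt (∑ k, ∑ l, (r k * r l) • G₂ k l) (fromRows (∑ k, ∑ l, (r k * r l) • R₂ k l) (0 : Matrix ρ₃ ν₃ ℝ))))
    (a b : σ) :
    mixedVar N₀ (fromBlocks (N₁ a) (-(fromRows (M₁ a) (0 : Matrix ρ₁ ν₁ ℝ))ᵀ) (fromRows (M₁ a) (0 : Matrix ρ₁ ν₁ ℝ)) 0)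
        (fromBlocks (N₁ b) (-(fromRows (M₁ b) (0 : Matrix ρ₁ ν₁ ℝ))ᵀ) (fromRows (M₁ b) (0 : Matrix ρ₁ ν₁ ℝ)) 0)
        (kkt (N₂ a b) (fromRows (M₂ a b) (0 : Matrix ρ₁ ν₁ ℝ)))
      = mixedVar F₀ (fromBlocks (F₁ a) (-(fromRows (E₁ a) (0 : Matrix ρ₂ ν₂ ℝ))ᵀ) (fromRows (E₁ a) (0 : Matrix ρ₂ ν₂ ℝ)) 0)
          (fromBlocks (F₁ b) (-(fromRows (E₁ b) (0 : Matrix ρ₂ ν₂ ℝ))ᵀ) (fromRows (E₁ b) (0 : Matrix ρ₂ ν₂ ℝ)) 0)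
          (kkt (F₂ a b) (fromRows (E₂ a b) (0 : Matrix ρ₂ ν₂ ℝ)))
        + mixedVar G₀ (fromBlocks (G₁ a) (-(fromRows (R₁ a) (0 : Matrix ρ₃ ν₃ ℝ))ᵀ) (fromRows (R₁ a) (0 : Matrix ρ₃ ν₃ ℝ)) 0)
          (fromBlocks (G₁ b) (-(fromRows (R₁ b) (0 : Matrix ρ₃ ν₃ ℝ))ᵀ) (fromRows (R₁ b) (0 : Matrix ρ₃ ν₃ ℝ)) 0)
          (kkt (G₂ a b) (fromRows (R₂ a b) (0 : Matrix ρ₃ ν₃ ℝ))) := by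
  refine mixedVar_kernel_law_of_secondVar_law N₀
    (fun k => fromBlocks (N₁ k) (-(fromRows (M₁ k) (0 : Matrix ρ₁ ν₁ ℝ))ᵀ) (fromRows (M₁ k) (0 : Matrix ρ₁ ν₁ ℝ)) 0)
    (fun k l => kkt (N₂ k l) (fromRows (M₂ k l) (0 : Matrix ρ₁ ν₁ ℝ)))
    F₀ (fun k => fromBlocks (F₁ k) (-(fromRows (E₁ k) (0 : Matrix ρ₂ ν₂ ℝ))ᵀ) (fromRows (E₁ k) (0 : Matrix ρ₂ ν₂ ℝ)) 0)
    (fun k l => kkt (F₂ k l) (fromRows (E₂ k l) (0 : Matrix ρ₂ ν₂ ℝ)))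
    G₀ (fun k => fromBlocks (G₁ k) (-(fromRows (R₁ k) (0 : Matrix ρ₃ ν₃ ℝ))ᵀ) (fromRows (R₁ k) (0 : Matrix ρ₃ ν₃ ℝ)) 0)
    (fun k l => kkt (G₂ k l) (fromRows (R₂ k l) (0 : Matrix ρ₃ ν₃ ℝ)))
    (fun k l => ?_) (fun k l => ?_) (fun k l => ?_) (fun r => ?_) a b
  · simp only [hN₂ k l, hM₂ k l]
  · simp only [hF₂ k l, hE₂ k l]
  · simp only [hG₂ k l, hR₂ k l]
  · simp only [sum_smul_signTwist_zeroSlice, sum_sum_smul_kkt_zeroSlice]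
    exact hlaw r

end GradedDoor

end Summit.QuantumFields.BalabanUV.Beta.FP.SecondVarKernelLaw

end
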